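import Summits.AtomisticToContinuum.BoseEinsteinCondensation.Theses.BECThomsonPrinciple
import Literature.MathematicalPhysics.QuantumManyBody.PeriodicBoseGasFracEnergy

/-!
# Line `dual-norm-healed-witness` — checked skeleton for crux `BECThomsonPrinciple.GDTransfer`
(stmt-AtomisticToContinuum-9482 · route route-AtomisticToContinuum-BECThomsonPrinciple · crux-plan, round 1)

Crux (by name, never restated): `GDTransfer := GDCan → PeriodicBEC`, i.e. canonical `T = 0` Gaussian domination
on the torus (chord form, LNSS source `Λ_k† = a_k† a_0 n̂₀^{-1/2}`) implies condensation of the `δ`-near-minimisers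
of the periodic energy at every small density.

Idea (card `Ideas/dual-norm-healed-witness.md`): read GD as a DUAL-NORM bound on the fixed vector
`ζ = Λ_pΨ` (`‖ζ‖² = n_p` exactly) and run Kennedy–Lieb–Shastry ONE-SIDEDLY with a free witness `η` in the
form domain: `n_p ≤ 2√(Γ_p·Q̃(η)) + ‖ζ − η‖²`, `Γ_p = C L²/‖p‖²`, `Q̃(η) = q(η) − E₀‖η‖²`. For `∫v < ∞` the
witness is `η = ζ`; for `v ∉ L¹` (hard cores) `η` is the thin-layer HEALED `ζ`, whose energy is booked by the
identity `Q(hζ) = ∫|∇h|²|ζ|² − k²‖hζ‖² − Re⟨hζ, hΛ_pσ⟩` (σ = contact single layer) and a Rellich trace budget.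

## Registered stubs (each a `theorem stub_… : <self-contained signature> := by sorry`)
All signatures are written in the context
`open MeasureTheory Filter` · `open scoped ENNReal NNReal` · `open Literature.MathematicalPhysics.QuantumManyBody.BoseGas`
(route decls fully qualified). `N = m + 1` particles as in `GaussianDominationCan`; `p ∈ ℤ³`, `k = 2πp/L`,
`‖p‖` = sup norm as in the route; the excitation vector `ζ = Λ_pΨ = Σ_{S ≠ ∅} |S|^{-1/2} Q_S (Σ_i P_i^{(p)} Ψ)` is
introduced by the binders `∀ P, P = … → ∀ Q, Q = … → ∀ ζ, ζ = … →` (no `let`: the registrar cuts at `:=`).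

* `stub_modeCounting` (A · provable now · M/L) — PER-MODE INFRARED BOUND ⇒ CONDENSATION: if the near-minimisers
  at small density obey `n_p ≤ A + Bρ(L/‖p‖)²` on the window `0 < 2π‖p‖/L ≤ M√ρ` (every `M`, constants after
  `M`), then `PeriodicBEC(v)`. Proof route: `Σ_p n_p = N` (`PeriodicTrialState.tsum_cellOccupation_planeWaveMode`),
  `Σ_p |2πp/L|² n_p = T(Ψ) ≤ E₀ + δ` (`tsum_fracDispersion_two_mul_cellOccupation`), Dyson's bound
  `LSSY2005_upperBound_periodic_holds` (`E₀ ≤ 4πaρN(1+Ca/b)`, finite ⇒ also discharges `E₀ ≠ ⊤`), kinetic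
  Chebyshev above the window (`≤ N/8` once `M² ≥ 32πa(1+Cc)`), and the `d = 3` sup-norm lattice count
  `#{0<‖p‖∞≤J} ≤ 26J³`, `Σ 1/‖p‖∞² ≤ 26J` (window sum `= O(M³√ρ + M√ρ)·N ≤ N/8` for `ρ` small); `c = 1/2`.
* `stub_excitationNorm` (D · provable now · M) — LNSS ALGEBRA `Λ_p†Λ_p = n̂_p` in configuration space:
  `∫_{cell^N} |ζ|² = cellOccupation N L φ_p Ψ` for every periodic trial state (Bose symmetry is essential: the
  identity fails for non-symmetric tensors — toy check in the planner's folder), every `p` (also `p = 0`).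
* `stub_dualNormKLS` (B · L) — GD AS A DUAL NORM + ONE-SIDED KLS AT NEAR-MINIMISERS: from
  `GaussianDominationCan` (by name), for `E₀ ≠ ⊤`, every tolerance `τ > 0` and a-priori class bound `Λ` there is
  `δ > 0` such that for every `δ`-near-minimiser `Ψ`, every window `p` and every admissible witness `η`
  (`C¹`, periodic, Bose-symmetric, `q(η) < ∞`, `q(η), ‖η‖² ≤ Λ`):
  `‖ζ‖² ≤ 2√(C L²/‖p‖² · Q̃(η)) + ‖ζ − η‖² + τ`. Proof route: GD along `(Ψ + t e^{iθ}η)/‖·‖` (a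
  `PeriodicTrialState` via `PeriodicTrialState.ofFun`), `|X(Ψ)| ≤ 2√(Γδ)`, first variation `≤ 2√(δQ̃(η))`
  (Cauchy–Schwarz for `Q̃ ≥ 0`), `s`-optimisation and `t = δ^{1/4}` (= `ChordLimitKLS` of card
  slack-first-phase-averaged-kls, `Cruxes/GDTransfer/SketchIdeator3.lean`), phase average over `θ` kills
  `⟨η, Λ†Ψ⟩` and leaves `|⟨ζ,η⟩|² ≤ ΓQ̃(η) + o_δ(1)`; then `‖ζ‖² ≤ 2|⟨ζ,η⟩| + ‖ζ−η‖²`.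
* `stub_healedWitness` (C · HARDEST · the card) — HEALED WITNESSES WITH BUDGETS: for every admissible `v` and
  window parameter `M`: constants `c₁, c₂ ≥ 0`, `θ ≤ 1/4` (after `v, M`, before `N, L, ρ`) such that at small
  density, for `E₀ ≠ ⊤`, there are `Λ` and `δ > 0` with: every `δ`-near-minimiser `Ψ` and window `p` admit an
  admissible witness `η` with `‖ζ − η‖² ≤ θ(‖ζ‖² + 1)` and `Q̃(η) ≤ (c₁k² + c₂ρ)(‖ζ‖² + 1)`. Soft `v`: `η = ζ`
  (`Q̃(Λ_pΨ₀) ≤ Q̃(Λ_pΨ₀) + Q̃(Λ_p†Ψ₀) = ½⟨[A,[H,A]]⟩ ≤ (2k² + Cρ‖v‖₁)(2n_p+1)`, `A = Λ_p + Λ_p†`). Hard core: own-shell multiplicative healing at scale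
  `a`, Newton repair / escort of the `n̂₀^{-1/2}`-induced foreign-shell violations (triage r1-2), the
  healed-witness identity, Rellich–Pohozaev trace budget `Σ∫|∂ₙΨ₀|² ≲ a⁻¹T(Ψ₀) + aE₀`, and the PER-MODE bound
  on the contact form factor `−Re⟨hζ,hΛ_pσ⟩ ≤ (c₁k² + c₂ρ)(n_p+1)` (it is `≥ k²‖hζ‖² − ∫|∇h|²|ζ|²` since `Q ≥ 0`,
  so it is of coherent size `≈ 2k²n_p`: a per-mode statement is forced). The near-minimiser is handled by the
  order of limits `δ(N) → 0` first (`∃ δ` after `∀ N`), as in (B).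

## Composition (sorry-free; `GDTransfer_of` concludes the crux BY NAME)
`perModeIR_of_parts`: with `Z = ‖ζ‖²`, (B) at `τ = 1` + (C) give `Z ≤ 2√(G(Z+1)) + θ(Z+1) + 1`,
`G = Γ_p(c₁k² + c₂ρ) = 4π²Cc₁ + Cc₂ρL²/‖p‖²`; `2√(G(Z+1)) ≤ 4G + (Z+1)/4` and `θ ≤ 1/4` give `Z ≤ 8G + 3`, i.e.
the per-mode infrared bound with `A = 32π²Cc₁ + 3`, `B = 8Cc₂`; (D) turns `Z` into `cellOccupation`, and the
`(m+1, L)`-shape is moved to `(N, sideLength ρ N)` by `div_sideLength_pow_three`. `gdTransfer_of_parts` feeds this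
into (A); `GDTransfer_of := gdTransfer_of_parts stub_modeCounting stub_excitationNorm stub_dualNormKLS stub_healedWitness`.

## Disproof used (standing disprover, evidence notes gen-1 v1–v4, gen-2 v1–v3b; the `.lean` is not mounted here)
`gdTransferPointwise_false_without_finiteRange` / `no_certificate_of_groundStateEnergy_top`: every stub that
quantifies over near-minimisers carries `E₀ ≠ ⊤` ((B), (C)) or discharges it by Dyson ((A)) — the line USES
`E₀^per < ∞` at low density; `gdChord_of_energy_top` (GD is `_ ≤ ⊤`-silent at infinite-energy states):
witnesses are required to have `q(η) ≠ ⊤` and GD is only ever applied along finite-energy rays ((B));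
`periodicBECAtLinearWindow_false`: `δ` is existential after `∀ᶠ N` everywhere (resolution `δ(N) → 0`, never
`εN`); `truncation_dichotomy` (§5): no truncation `v ∧ n` anywhere — constants `c₁, c₂` are `∃` after `v`;
`gaussianDominationCan_free_constant_ge` (C ≥ 1/4π² at v = 0): `C` enters only through `A = 32π²Cc₁ + 3`,
`B = 8Cc₂`; `window_fraction_vanishes_iff_three_le`: `d = 3` enters exactly in (A)'s lattice count. No
`Theorems/GDTransfer/Negative/` lemma has landed (nothing to import).
-/

noncomputable section

namespace Summit.AtomisticToContinuum.BoseEinsteinCondensation.Cruxes.GDTransfer.DualNormHealedWitness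

open MeasureTheory Filter
open scoped ENNReal NNReal
open Literature.MathematicalPhysics.QuantumManyBody.BoseGas

/-! ## The four registered stubs -/

/-- **Stub (A) `stub_modeCounting` — per-mode infrared bound on the window ⇒ condensation (provable now).**
For an admissible `v`: if for every window parameter `M > 0` there are `ρ₁, A, B` such that at every density
`ρ < ρ₁`, for all large `N` with `E₀^per(N, L_N) < ∞` (`L_N = (N/ρ)^{1/3}`), some `δ > 0` makes every
`δ`-near-minimiser satisfy `n_p ≤ A + Bρ L_N²/‖p‖²` for all `p ≠ 0` with `2π‖p‖/L_N ≤ M√ρ`, then the consequent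
of `GDTransfer` holds at `v` (window sum `O((M³+M)√ρ)N`, kinetic Chebyshev tail `≤ (E₀+δ)/(M²ρ)` with Dyson's
`LSSY2005_upperBound_periodic_holds`, `Σ_p n_p = N`). -/
theorem stub_modeCounting :
    ∀ v : ℝ → ℝ≥0∞, IsRepulsiveFiniteRange v → (∀ M : ℝ, 0 < M → ∃ ρ₁ A B : ℝ, 0 < ρ₁ ∧ 0 ≤ A ∧ 0 ≤
    B ∧ ∀ ρ : ℝ, 0 < ρ → ρ < ρ₁ → ∀ᶠ N : ℕ in Filter.atTop, periodicGroundStateEnergy v N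
    (sideLength ρ N) ≠ ⊤ → ∃ δ : ℝ≥0∞, 0 < δ ∧ ∀ Ψ : PeriodicTrialState N (sideLength ρ N),
    periodicEnergy v Ψ ≤ periodicGroundStateEnergy v N (sideLength ρ N) + δ → ∀ p : Fin 3 → ℤ, p ≠ 0
    → 2 * Real.pi * ‖(fun j => (p j : ℝ))‖ / sideLength ρ N ≤ M * Real.sqrt ρ → cellOccupation N
    (sideLength ρ N) (planeWaveMode (sideLength ρ N) p) Ψ.ψ ≤ ENNReal.ofReal (A + B * ρ * sideLength
    ρ N ^ 2 / ‖(fun j => (p j : ℝ))‖ ^ 2)) → ∃ ρ₀ : ℝ, 0 < ρ₀ ∧ ∀ ρ : ℝ, 0 < ρ → ρ < ρ₀ → ∃ c : ℝ, 0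
    < c ∧ ∀ᶠ N : ℕ in Filter.atTop, ∃ δ : ℝ≥0∞, 0 < δ ∧ ∀ Ψ : PeriodicTrialState N (sideLength ρ N),
    periodicEnergy v Ψ ≤ periodicGroundStateEnergy v N (sideLength ρ N) + δ → ENNReal.ofReal (c * N)
    ≤ condensateOccupation N (sideLength ρ N) Ψ.ψ := by
  sorry

/-- **Stub (D) `stub_excitationNorm` — LNSS algebra `‖Λ_pΨ‖² = ⟨Ψ, n̂_pΨ⟩` in configuration space (provable now).**
`P i` = cell average of slot `i`, `Q S` = projection onto "slots in `S` condensed, the others orthogonal to the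
constant", `ζ = Σ_{S ≠ ∅} |S|^{-1/2} Q_S (Σ_i P_i^{(p)} Ψ) = n̂₀^{-1/2} a_0† a_p Ψ`; then
`∫_{cell^N}|ζ|² = cellOccupation N L φ_p Ψ = n_p` (`a_0 n̂₀⁻¹ a_0† = 1`; Bose symmetry of `Ψ` is essential). -/
theorem stub_excitationNorm :
    ∀ m : ℕ, ∀ L : ℝ, 0 < L → ∀ Ψ : PeriodicTrialState (m + 1) L, ∀ p : Fin 3 → ℤ, ∀ P : Fin (m + 1)
    → (Config (m + 1) → ℂ) → Config (m + 1) → ℂ, P = (fun i g X => ((L ^ 3)⁻¹ : ℝ) • ∫ y in cell L,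
    g (Function.update X i y)) → ∀ Q : Finset (Fin (m + 1)) → (Config (m + 1) → ℂ) → Config (m + 1)
    → ℂ, Q = (fun S g => (List.finRange (m + 1)).foldr (fun i h => if i ∈ S then P i h else h - P i
    h) g) → ∀ ζ : Config (m + 1) → ℂ, ζ = (fun X => ∑ S ∈ (Finset.univ : Finset (Finset (Fin (m +
    1)))).filter (fun S => S.Nonempty), ((Real.sqrt (S.card : ℝ))⁻¹ : ℂ) * Q S (fun Y => ∑ i : Fin
    (m + 1), ((L ^ 3)⁻¹ : ℝ) • ∫ y in cell L, Complex.exp (-(Complex.I * ↑(2 * Real.pi / L * ∑ j, (p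
    j : ℝ) * y j))) * Ψ.ψ (Function.update Y i y)) X) → (∫⁻ X in cellN (m + 1) L, (‖ζ X‖₊ : ℝ≥0∞) ^
    2) = cellOccupation (m + 1) L (planeWaveMode L p) Ψ.ψ := by
  sorry

/-- **Stub (B) `stub_dualNormKLS` — Gaussian domination as a dual-norm bound; one-sided KLS at near-minimisers.**
From `GaussianDominationCan`: with the same `ρ₀, C, N₀` shape, whenever `E₀ ≠ ⊤`, for every tolerance `τ > 0`
and class bound `Λ` there is `δ > 0` such that for every `δ`-near-minimiser `Ψ`, window `p` and admissible
witness `η` (`C¹`, periodic, Bose-symmetric, finite form `q(η)`, `q(η), ‖η‖² ≤ Λ`):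
`‖ζ‖² ≤ 2 √(C L²/‖p‖² · (q(η) − E₀‖η‖²)) + ‖ζ − η‖² + τ`. -/
theorem stub_dualNormKLS :
    Summit.AtomisticToContinuum.BoseEinsteinCondensation.Theses.BECThomsonPrinciple.GaussianDominationCan
    → ∀ v : ℝ → ℝ≥0∞, IsRepulsiveFiniteRange v → ∀ M : ℝ, 0 < M → ∃ ρ₀ C : ℝ, 0 < ρ₀ ∧ 0 < C ∧ ∃ N₀
    : ℕ, ∀ m : ℕ, N₀ ≤ m + 1 → ∀ L : ℝ, 0 < L → ((m + 1 : ℕ) : ℝ) ≤ ρ₀ * L ^ 3 →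
    periodicGroundStateEnergy v (m + 1) L ≠ ⊤ → ∀ τ Λ : ℝ, 0 < τ → ∃ δ : ℝ≥0∞, 0 < δ ∧ ∀ Ψ :
    PeriodicTrialState (m + 1) L, periodicEnergy v Ψ ≤ periodicGroundStateEnergy v (m + 1) L + δ → ∀
    p : Fin 3 → ℤ, p ≠ 0 → 2 * Real.pi * ‖(fun j => (p j : ℝ))‖ / L ≤ M * Real.sqrt (((m + 1 : ℕ) :
    ℝ) / L ^ 3) → ∀ P : Fin (m + 1) → (Config (m + 1) → ℂ) → Config (m + 1) → ℂ, P = (fun i g X =>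
    ((L ^ 3)⁻¹ : ℝ) • ∫ y in cell L, g (Function.update X i y)) → ∀ Q : Finset (Fin (m + 1)) →
    (Config (m + 1) → ℂ) → Config (m + 1) → ℂ, Q = (fun S g => (List.finRange (m + 1)).foldr (fun i
    h => if i ∈ S then P i h else h - P i h) g) → ∀ ζ : Config (m + 1) → ℂ, ζ = (fun X => ∑ S ∈
    (Finset.univ : Finset (Finset (Fin (m + 1)))).filter (fun S => S.Nonempty), ((Real.sqrt (S.card
    : ℝ))⁻¹ : ℂ) * Q S (fun Y => ∑ i : Fin (m + 1), ((L ^ 3)⁻¹ : ℝ) • ∫ y in cell L, Complex.exp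
    (-(Complex.I * ↑(2 * Real.pi / L * ∑ j, (p j : ℝ) * y j))) * Ψ.ψ (Function.update Y i y)) X) → ∀
    η : Config (m + 1) → ℂ, ContDiff ℝ 1 η → (∀ (X : Config (m + 1)) (i : Fin (m + 1)) (k : Fin 3),
    η (X + Pi.single i (EuclideanSpace.single k L)) = η X) → (∀ (σ : Equiv.Perm (Fin (m + 1))) (X :
    Config (m + 1)), η (X ∘ σ) = η X) → (∫⁻ X in cellN (m + 1) L, kineticDensity η X +
    periodicInteraction v L X * (‖η X‖₊ : ℝ≥0∞) ^ 2) ≠ ⊤ → (∫⁻ X in cellN (m + 1) L, kineticDensity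
    η X + periodicInteraction v L X * (‖η X‖₊ : ℝ≥0∞) ^ 2).toReal ≤ Λ → (∫⁻ X in cellN (m + 1) L,
    (‖η X‖₊ : ℝ≥0∞) ^ 2).toReal ≤ Λ → (∫⁻ X in cellN (m + 1) L, (‖ζ X‖₊ : ℝ≥0∞) ^ 2).toReal ≤ 2 *
    Real.sqrt (C * L ^ 2 / ‖(fun j => (p j : ℝ))‖ ^ 2 * ((∫⁻ X in cellN (m + 1) L, kineticDensity η
    X + periodicInteraction v L X * (‖η X‖₊ : ℝ≥0∞) ^ 2).toReal - (periodicGroundStateEnergy v (m +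
    1) L).toReal * (∫⁻ X in cellN (m + 1) L, (‖η X‖₊ : ℝ≥0∞) ^ 2).toReal)) + (∫⁻ X in cellN (m + 1)
    L, (‖ζ X - η X‖₊ : ℝ≥0∞) ^ 2).toReal + τ := by
  sorry

/-- **Stub (C) `stub_healedWitness` — healed witnesses with `L²` and energy budgets (HARDEST; the card's content).**
For every admissible `v` and window parameter `M` there are `ρ₀ > 0`, `c₁, c₂ ≥ 0`, `0 ≤ θ ≤ 1/4`, `N₀` such that
for `N = m+1 ≥ N₀`, `N ≤ ρ₀L³`, `E₀ ≠ ⊤`: some class bound `Λ` and `δ > 0` give, for every `δ`-near-minimiser `Ψ`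
and window `p`, an admissible witness `η` with `‖ζ − η‖² ≤ θ(‖ζ‖² + 1)` and
`q(η) − E₀‖η‖² ≤ (c₁ k² + c₂ ρ)(‖ζ‖² + 1)` (`k = 2π‖p‖/L`, `ρ = N/L³`). -/
theorem stub_healedWitness :
    ∀ v : ℝ → ℝ≥0∞, IsRepulsiveFiniteRange v → ∀ M : ℝ, 0 < M → ∃ ρ₀ c₁ c₂ θ : ℝ, 0 < ρ₀ ∧ 0 ≤ c₁ ∧
    0 ≤ c₂ ∧ 0 ≤ θ ∧ θ ≤ 1 / 4 ∧ ∃ N₀ : ℕ, ∀ m : ℕ, N₀ ≤ m + 1 → ∀ L : ℝ, 0 < L → ((m + 1 : ℕ) : ℝ)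
    ≤ ρ₀ * L ^ 3 → periodicGroundStateEnergy v (m + 1) L ≠ ⊤ → ∃ Λ : ℝ, ∃ δ : ℝ≥0∞, 0 < δ ∧ ∀ Ψ :
    PeriodicTrialState (m + 1) L, periodicEnergy v Ψ ≤ periodicGroundStateEnergy v (m + 1) L + δ → ∀
    p : Fin 3 → ℤ, p ≠ 0 → 2 * Real.pi * ‖(fun j => (p j : ℝ))‖ / L ≤ M * Real.sqrt (((m + 1 : ℕ) :
    ℝ) / L ^ 3) → ∀ P : Fin (m + 1) → (Config (m + 1) → ℂ) → Config (m + 1) → ℂ, P = (fun i g X =>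
    ((L ^ 3)⁻¹ : ℝ) • ∫ y in cell L, g (Function.update X i y)) → ∀ Q : Finset (Fin (m + 1)) →
    (Config (m + 1) → ℂ) → Config (m + 1) → ℂ, Q = (fun S g => (List.finRange (m + 1)).foldr (fun i
    h => if i ∈ S then P i h else h - P i h) g) → ∀ ζ : Config (m + 1) → ℂ, ζ = (fun X => ∑ S ∈
    (Finset.univ : Finset (Finset (Fin (m + 1)))).filter (fun S => S.Nonempty), ((Real.sqrt (S.card
    : ℝ))⁻¹ : ℂ) * Q S (fun Y => ∑ i : Fin (m + 1), ((L ^ 3)⁻¹ : ℝ) • ∫ y in cell L, Complex.exp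
    (-(Complex.I * ↑(2 * Real.pi / L * ∑ j, (p j : ℝ) * y j))) * Ψ.ψ (Function.update Y i y)) X) → ∃
    η : Config (m + 1) → ℂ, ContDiff ℝ 1 η ∧ (∀ (X : Config (m + 1)) (i : Fin (m + 1)) (k : Fin 3),
    η (X + Pi.single i (EuclideanSpace.single k L)) = η X) ∧ (∀ (σ : Equiv.Perm (Fin (m + 1))) (X :
    Config (m + 1)), η (X ∘ σ) = η X) ∧ (∫⁻ X in cellN (m + 1) L, kineticDensity η X +
    periodicInteraction v L X * (‖η X‖₊ : ℝ≥0∞) ^ 2) ≠ ⊤ ∧ (∫⁻ X in cellN (m + 1) L, kineticDensity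
    η X + periodicInteraction v L X * (‖η X‖₊ : ℝ≥0∞) ^ 2).toReal ≤ Λ ∧ (∫⁻ X in cellN (m + 1) L,
    (‖η X‖₊ : ℝ≥0∞) ^ 2).toReal ≤ Λ ∧ (∫⁻ X in cellN (m + 1) L, (‖ζ X - η X‖₊ : ℝ≥0∞) ^ 2).toReal ≤
    θ * ((∫⁻ X in cellN (m + 1) L, (‖ζ X‖₊ : ℝ≥0∞) ^ 2).toReal + 1) ∧ ((∫⁻ X in cellN (m + 1) L,
    kineticDensity η X + periodicInteraction v L X * (‖η X‖₊ : ℝ≥0∞) ^ 2).toReal -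
    (periodicGroundStateEnergy v (m + 1) L).toReal * (∫⁻ X in cellN (m + 1) L, (‖η X‖₊ : ℝ≥0∞) ^
    2).toReal) ≤ (c₁ * (2 * Real.pi * ‖(fun j => (p j : ℝ))‖ / L) ^ 2 + c₂ * (((m + 1 : ℕ) : ℝ) / L
    ^ 3)) * ((∫⁻ X in cellN (m + 1) L, (‖ζ X‖₊ : ℝ≥0∞) ^ 2).toReal + 1) := by
  sorry

/-! ## Composition (sorry-free) -/

/-- The cell average `P_i` of slot `i` (the route's inline `P`). -/
def POp (m : ℕ) (L : ℝ) : Fin (m + 1) → (Config (m + 1) → ℂ) → Config (m + 1) → ℂ :=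
  fun i g X => ((L ^ 3)⁻¹ : ℝ) • ∫ y in cell L, g (Function.update X i y)

/-- The projection `Q_S` (the route's inline `Q`). -/
def QOp (m : ℕ) (L : ℝ) : Finset (Fin (m + 1)) → (Config (m + 1) → ℂ) → Config (m + 1) → ℂ :=
  fun S g => (List.finRange (m + 1)).foldr (fun i h => if i ∈ S then POp m L i h else h - POp m L i h) g

/-- The LNSS excitation vector `ζ = Λ_p ψ` in configuration space. -/
def zetaOp (m : ℕ) (L : ℝ) (p : Fin 3 → ℤ) (Ψ : PeriodicTrialState (m + 1) L) : Config (m + 1) → ℂ :=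
  fun X => ∑ S ∈ (Finset.univ : Finset (Finset (Fin (m + 1)))).filter (fun S => S.Nonempty),
    ((Real.sqrt (S.card : ℝ))⁻¹ : ℂ) * QOp m L S (fun Y => ∑ i : Fin (m + 1), ((L ^ 3)⁻¹ : ℝ) • ∫ y in cell L,
      Complex.exp (-(Complex.I * ↑(2 * Real.pi / L * ∑ j, (p j : ℝ) * y j))) * Ψ.ψ (Function.update Y i y)) X

/-- The per-mode infrared interface between the KLS side and mode counting. -/
def PerModeIR (v : ℝ → ℝ≥0∞) : Prop :=
  ∀ M : ℝ, 0 < M → ∃ ρ₁ A B : ℝ, 0 < ρ₁ ∧ 0 ≤ A ∧ 0 ≤ B ∧ ∀ ρ : ℝ, 0 < ρ → ρ < ρ₁ → ∀ᶠ N : ℕ in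
  Filter.atTop, periodicGroundStateEnergy v N (sideLength ρ N) ≠ ⊤ → ∃ δ : ℝ≥0∞, 0 < δ ∧ ∀ Ψ :
  PeriodicTrialState N (sideLength ρ N), periodicEnergy v Ψ ≤ periodicGroundStateEnergy v N
  (sideLength ρ N) + δ → ∀ p : Fin 3 → ℤ, p ≠ 0 → 2 * Real.pi * ‖(fun j => (p j : ℝ))‖ / sideLength
  ρ N ≤ M * Real.sqrt ρ → cellOccupation N (sideLength ρ N) (planeWaveMode (sideLength ρ N) p) Ψ.ψ ≤
  ENNReal.ofReal (A + B * ρ * sideLength ρ N ^ 2 / ‖(fun j => (p j : ℝ))‖ ^ 2)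

/-- The consequent of the crux at `v` (verbatim `BECPeriodicReduction.PeriodicBEC` at `v`). -/
def PeriodicBECAt (v : ℝ → ℝ≥0∞) : Prop :=
  ∃ ρ₀ : ℝ, 0 < ρ₀ ∧ ∀ ρ : ℝ, 0 < ρ → ρ < ρ₀ → ∃ c : ℝ, 0 < c ∧ ∀ᶠ N : ℕ in Filter.atTop, ∃ δ :
  ℝ≥0∞, 0 < δ ∧ ∀ Ψ : PeriodicTrialState N (sideLength ρ N), periodicEnergy v Ψ ≤
  periodicGroundStateEnergy v N (sideLength ρ N) + δ → ENNReal.ofReal (c * N) ≤ condensateOccupation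
  N (sideLength ρ N) Ψ.ψ

/-- Statement of stub (A), as a `Prop` (same text). -/
def ModeCountingStmt : Prop :=
  ∀ v : ℝ → ℝ≥0∞, IsRepulsiveFiniteRange v → (∀ M : ℝ, 0 < M → ∃ ρ₁ A B : ℝ, 0 < ρ₁ ∧ 0 ≤ A ∧ 0 ≤ B
  ∧ ∀ ρ : ℝ, 0 < ρ → ρ < ρ₁ → ∀ᶠ N : ℕ in Filter.atTop, periodicGroundStateEnergy v N (sideLength ρ
  N) ≠ ⊤ → ∃ δ : ℝ≥0∞, 0 < δ ∧ ∀ Ψ : PeriodicTrialState N (sideLength ρ N), periodicEnergy v Ψ ≤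
  periodicGroundStateEnergy v N (sideLength ρ N) + δ → ∀ p : Fin 3 → ℤ, p ≠ 0 → 2 * Real.pi * ‖(fun
  j => (p j : ℝ))‖ / sideLength ρ N ≤ M * Real.sqrt ρ → cellOccupation N (sideLength ρ N)
  (planeWaveMode (sideLength ρ N) p) Ψ.ψ ≤ ENNReal.ofReal (A + B * ρ * sideLength ρ N ^ 2 / ‖(fun j
  => (p j : ℝ))‖ ^ 2)) → ∃ ρ₀ : ℝ, 0 < ρ₀ ∧ ∀ ρ : ℝ, 0 < ρ → ρ < ρ₀ → ∃ c : ℝ, 0 < c ∧ ∀ᶠ N : ℕ in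
  Filter.atTop, ∃ δ : ℝ≥0∞, 0 < δ ∧ ∀ Ψ : PeriodicTrialState N (sideLength ρ N), periodicEnergy v Ψ
  ≤ periodicGroundStateEnergy v N (sideLength ρ N) + δ → ENNReal.ofReal (c * N) ≤
  condensateOccupation N (sideLength ρ N) Ψ.ψ

/-- Statement of stub (D), as a `Prop` (same text). -/
def ExcitationNormStmt : Prop :=
  ∀ m : ℕ, ∀ L : ℝ, 0 < L → ∀ Ψ : PeriodicTrialState (m + 1) L, ∀ p : Fin 3 → ℤ, ∀ P : Fin (m + 1) →
  (Config (m + 1) → ℂ) → Config (m + 1) → ℂ, P = (fun i g X => ((L ^ 3)⁻¹ : ℝ) • ∫ y in cell L, g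
  (Function.update X i y)) → ∀ Q : Finset (Fin (m + 1)) → (Config (m + 1) → ℂ) → Config (m + 1) → ℂ,
  Q = (fun S g => (List.finRange (m + 1)).foldr (fun i h => if i ∈ S then P i h else h - P i h) g) →
  ∀ ζ : Config (m + 1) → ℂ, ζ = (fun X => ∑ S ∈ (Finset.univ : Finset (Finset (Fin (m + 1)))).filter
  (fun S => S.Nonempty), ((Real.sqrt (S.card : ℝ))⁻¹ : ℂ) * Q S (fun Y => ∑ i : Fin (m + 1), ((L ^
  3)⁻¹ : ℝ) • ∫ y in cell L, Complex.exp (-(Complex.I * ↑(2 * Real.pi / L * ∑ j, (p j : ℝ) * y j)))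
  * Ψ.ψ (Function.update Y i y)) X) → (∫⁻ X in cellN (m + 1) L, (‖ζ X‖₊ : ℝ≥0∞) ^ 2) =
  cellOccupation (m + 1) L (planeWaveMode L p) Ψ.ψ

/-- Statement of stub (B), as a `Prop` (same text). -/
def DualNormKLSStmt : Prop :=
  Summit.AtomisticToContinuum.BoseEinsteinCondensation.Theses.BECThomsonPrinciple.GaussianDominationCan
  → ∀ v : ℝ → ℝ≥0∞, IsRepulsiveFiniteRange v → ∀ M : ℝ, 0 < M → ∃ ρ₀ C : ℝ, 0 < ρ₀ ∧ 0 < C ∧ ∃ N₀ :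
  ℕ, ∀ m : ℕ, N₀ ≤ m + 1 → ∀ L : ℝ, 0 < L → ((m + 1 : ℕ) : ℝ) ≤ ρ₀ * L ^ 3 →
  periodicGroundStateEnergy v (m + 1) L ≠ ⊤ → ∀ τ Λ : ℝ, 0 < τ → ∃ δ : ℝ≥0∞, 0 < δ ∧ ∀ Ψ :
  PeriodicTrialState (m + 1) L, periodicEnergy v Ψ ≤ periodicGroundStateEnergy v (m + 1) L + δ → ∀ p
  : Fin 3 → ℤ, p ≠ 0 → 2 * Real.pi * ‖(fun j => (p j : ℝ))‖ / L ≤ M * Real.sqrt (((m + 1 : ℕ) : ℝ) /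
  L ^ 3) → ∀ P : Fin (m + 1) → (Config (m + 1) → ℂ) → Config (m + 1) → ℂ, P = (fun i g X => ((L ^
  3)⁻¹ : ℝ) • ∫ y in cell L, g (Function.update X i y)) → ∀ Q : Finset (Fin (m + 1)) → (Config (m +
  1) → ℂ) → Config (m + 1) → ℂ, Q = (fun S g => (List.finRange (m + 1)).foldr (fun i h => if i ∈ S
  then P i h else h - P i h) g) → ∀ ζ : Config (m + 1) → ℂ, ζ = (fun X => ∑ S ∈ (Finset.univ :
  Finset (Finset (Fin (m + 1)))).filter (fun S => S.Nonempty), ((Real.sqrt (S.card : ℝ))⁻¹ : ℂ) * Q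
  S (fun Y => ∑ i : Fin (m + 1), ((L ^ 3)⁻¹ : ℝ) • ∫ y in cell L, Complex.exp (-(Complex.I * ↑(2 *
  Real.pi / L * ∑ j, (p j : ℝ) * y j))) * Ψ.ψ (Function.update Y i y)) X) → ∀ η : Config (m + 1) →
  ℂ, ContDiff ℝ 1 η → (∀ (X : Config (m + 1)) (i : Fin (m + 1)) (k : Fin 3), η (X + Pi.single i
  (EuclideanSpace.single k L)) = η X) → (∀ (σ : Equiv.Perm (Fin (m + 1))) (X : Config (m + 1)), η (X
  ∘ σ) = η X) → (∫⁻ X in cellN (m + 1) L, kineticDensity η X + periodicInteraction v L X * (‖η X‖₊ :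
  ℝ≥0∞) ^ 2) ≠ ⊤ → (∫⁻ X in cellN (m + 1) L, kineticDensity η X + periodicInteraction v L X * (‖η
  X‖₊ : ℝ≥0∞) ^ 2).toReal ≤ Λ → (∫⁻ X in cellN (m + 1) L, (‖η X‖₊ : ℝ≥0∞) ^ 2).toReal ≤ Λ → (∫⁻ X in
  cellN (m + 1) L, (‖ζ X‖₊ : ℝ≥0∞) ^ 2).toReal ≤ 2 * Real.sqrt (C * L ^ 2 / ‖(fun j => (p j : ℝ))‖ ^
  2 * ((∫⁻ X in cellN (m + 1) L, kineticDensity η X + periodicInteraction v L X * (‖η X‖₊ : ℝ≥0∞) ^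
  2).toReal - (periodicGroundStateEnergy v (m + 1) L).toReal * (∫⁻ X in cellN (m + 1) L, (‖η X‖₊ :
  ℝ≥0∞) ^ 2).toReal)) + (∫⁻ X in cellN (m + 1) L, (‖ζ X - η X‖₊ : ℝ≥0∞) ^ 2).toReal + τ

/-- Statement of stub (C), as a `Prop` (same text). -/
def HealedWitnessStmt : Prop :=
  ∀ v : ℝ → ℝ≥0∞, IsRepulsiveFiniteRange v → ∀ M : ℝ, 0 < M → ∃ ρ₀ c₁ c₂ θ : ℝ, 0 < ρ₀ ∧ 0 ≤ c₁ ∧ 0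
  ≤ c₂ ∧ 0 ≤ θ ∧ θ ≤ 1 / 4 ∧ ∃ N₀ : ℕ, ∀ m : ℕ, N₀ ≤ m + 1 → ∀ L : ℝ, 0 < L → ((m + 1 : ℕ) : ℝ) ≤ ρ₀
  * L ^ 3 → periodicGroundStateEnergy v (m + 1) L ≠ ⊤ → ∃ Λ : ℝ, ∃ δ : ℝ≥0∞, 0 < δ ∧ ∀ Ψ :
  PeriodicTrialState (m + 1) L, periodicEnergy v Ψ ≤ periodicGroundStateEnergy v (m + 1) L + δ → ∀ p
  : Fin 3 → ℤ, p ≠ 0 → 2 * Real.pi * ‖(fun j => (p j : ℝ))‖ / L ≤ M * Real.sqrt (((m + 1 : ℕ) : ℝ) /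
  L ^ 3) → ∀ P : Fin (m + 1) → (Config (m + 1) → ℂ) → Config (m + 1) → ℂ, P = (fun i g X => ((L ^
  3)⁻¹ : ℝ) • ∫ y in cell L, g (Function.update X i y)) → ∀ Q : Finset (Fin (m + 1)) → (Config (m +
  1) → ℂ) → Config (m + 1) → ℂ, Q = (fun S g => (List.finRange (m + 1)).foldr (fun i h => if i ∈ S
  then P i h else h - P i h) g) → ∀ ζ : Config (m + 1) → ℂ, ζ = (fun X => ∑ S ∈ (Finset.univ :
  Finset (Finset (Fin (m + 1)))).filter (fun S => S.Nonempty), ((Real.sqrt (S.card : ℝ))⁻¹ : ℂ) * Q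
  S (fun Y => ∑ i : Fin (m + 1), ((L ^ 3)⁻¹ : ℝ) • ∫ y in cell L, Complex.exp (-(Complex.I * ↑(2 *
  Real.pi / L * ∑ j, (p j : ℝ) * y j))) * Ψ.ψ (Function.update Y i y)) X) → ∃ η : Config (m + 1) →
  ℂ, ContDiff ℝ 1 η ∧ (∀ (X : Config (m + 1)) (i : Fin (m + 1)) (k : Fin 3), η (X + Pi.single i
  (EuclideanSpace.single k L)) = η X) ∧ (∀ (σ : Equiv.Perm (Fin (m + 1))) (X : Config (m + 1)), η (X
  ∘ σ) = η X) ∧ (∫⁻ X in cellN (m + 1) L, kineticDensity η X + periodicInteraction v L X * (‖η X‖₊ :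
  ℝ≥0∞) ^ 2) ≠ ⊤ ∧ (∫⁻ X in cellN (m + 1) L, kineticDensity η X + periodicInteraction v L X * (‖η
  X‖₊ : ℝ≥0∞) ^ 2).toReal ≤ Λ ∧ (∫⁻ X in cellN (m + 1) L, (‖η X‖₊ : ℝ≥0∞) ^ 2).toReal ≤ Λ ∧ (∫⁻ X in
  cellN (m + 1) L, (‖ζ X - η X‖₊ : ℝ≥0∞) ^ 2).toReal ≤ θ * ((∫⁻ X in cellN (m + 1) L, (‖ζ X‖₊ :
  ℝ≥0∞) ^ 2).toReal + 1) ∧ ((∫⁻ X in cellN (m + 1) L, kineticDensity η X + periodicInteraction v L X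
  * (‖η X‖₊ : ℝ≥0∞) ^ 2).toReal - (periodicGroundStateEnergy v (m + 1) L).toReal * (∫⁻ X in cellN (m
  + 1) L, (‖η X‖₊ : ℝ≥0∞) ^ 2).toReal) ≤ (c₁ * (2 * Real.pi * ‖(fun j => (p j : ℝ))‖ / L) ^ 2 + c₂ *
  (((m + 1 : ℕ) : ℝ) / L ^ 3)) * ((∫⁻ X in cellN (m + 1) L, (‖ζ X‖₊ : ℝ≥0∞) ^ 2).toReal + 1)

/-- The sup norm of a non-zero lattice vector is positive. -/
theorem norm_intCast_pos {p : Fin 3 → ℤ} (hp : p ≠ 0) : 0 < ‖(fun j => (p j : ℝ))‖ := by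
  rw [norm_pos_iff]
  intro h
  apply hp
  funext j
  have := congr_fun h j
  simpa using this

/-- The real algebra of the one-sided KLS step: `Z ≤ 2√(Γ Q̃) + D + 1`, `D ≤ θ(Z+1)`, `Q̃ ≤ κ(Z+1)`,
`θ ≤ 1/4` give `Z ≤ 8Γκ + 3` (via `2√(G(Z+1)) ≤ 4G + (Z+1)/4`, `G = Γκ`). -/
theorem kls_real_algebra {Z D q E n Γ θ κ : ℝ} (hZ : 0 ≤ Z) (hΓ : 0 ≤ Γ) (hκ : 0 ≤ κ) (hθ : θ ≤ 1 / 4)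
    (hkls : Z ≤ 2 * Real.sqrt (Γ * (q - E * n)) + D + 1) (hdist : D ≤ θ * (Z + 1))
    (hener : q - E * n ≤ κ * (Z + 1)) : Z ≤ 8 * (Γ * κ) + 3 := by
  have hG0 : 0 ≤ Γ * κ := mul_nonneg hΓ hκ
  have h1 : Γ * (q - E * n) ≤ Γ * κ * (Z + 1) := by
    calc Γ * (q - E * n) ≤ Γ * (κ * (Z + 1)) := mul_le_mul_of_nonneg_left hener hΓ
      _ = Γ * κ * (Z + 1) := by ring
  have h3 : Real.sqrt (Γ * (q - E * n)) ≤ 2 * (Γ * κ) + (Z + 1) / 8 := by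
    calc Real.sqrt (Γ * (q - E * n)) ≤ Real.sqrt (Γ * κ * (Z + 1)) := Real.sqrt_le_sqrt h1
      _ ≤ Real.sqrt ((2 * (Γ * κ) + (Z + 1) / 8) ^ 2) :=
          Real.sqrt_le_sqrt (by nlinarith [sq_nonneg (2 * (Γ * κ) - (Z + 1) / 8)])
      _ = 2 * (Γ * κ) + (Z + 1) / 8 := Real.sqrt_sq (by positivity)
  have h4 : θ * (Z + 1) ≤ 1 / 4 * (Z + 1) := mul_le_mul_of_nonneg_right hθ (by linarith)
  linarith only [hkls, hdist, h3, h4, hG0, hZ]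

/-- **KLS side.** (B) at tolerance `1` with the witness of (C), the real algebra `kls_real_algebra`, and (D)
give the per-mode infrared bound (`A = 32π²Cc₁ + 3`, `B = 8Cc₂`). No `set`/`simp` touches the large
hypotheses: every match below is first-order unification on identical statement texts. -/
theorem perModeIR_of_parts (hD : ExcitationNormStmt) (hB : DualNormKLSStmt) (hC : HealedWitnessStmt)
    (hG : Summit.AtomisticToContinuum.BoseEinsteinCondensation.Theses.BECThomsonPrinciple.GaussianDominationCan)
    (v : ℝ → ℝ≥0∞) (hv : IsRepulsiveFiniteRange v) : PerModeIR v := by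
  intro M hM
  obtain ⟨ρB, C, hρB, hC0, NB, hBall⟩ := hB hG v hv M hM
  obtain ⟨ρC, c₁, c₂, θ, hρC, hc₁, hc₂, -, hθ, NC, hCall⟩ := hC v hv M hM
  refine ⟨min ρB ρC, 32 * Real.pi ^ 2 * C * c₁ + 3, 8 * C * c₂, lt_min hρB hρC, by positivity,
    by positivity, ?_⟩
  intro ρ hρ hρ1
  filter_upwards [eventually_ge_atTop (max NB NC + 1)] with N hN hE0
  obtain ⟨m, rfl⟩ : ∃ m, N = m + 1 := ⟨N - 1, by omega⟩
  have hLpos : 0 < sideLength ρ (m + 1) := by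
    unfold sideLength; positivity
  have hL3 : ((m + 1 : ℕ) : ℝ) / sideLength ρ (m + 1) ^ 3 = ρ := div_sideLength_pow_three hρ (Nat.succ_pos m)
  have hL3' : ((m + 1 : ℕ) : ℝ) = ρ * sideLength ρ (m + 1) ^ 3 :=
    (div_eq_iff (by positivity : sideLength ρ (m + 1) ^ 3 ≠ 0)).mp hL3
  have hdensB : ((m + 1 : ℕ) : ℝ) ≤ ρB * sideLength ρ (m + 1) ^ 3 := by
    rw [hL3']
    exact mul_le_mul_of_nonneg_right (hρ1.le.trans (min_le_left _ _)) (by positivity)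
  have hdensC : ((m + 1 : ℕ) : ℝ) ≤ ρC * sideLength ρ (m + 1) ^ 3 := by
    rw [hL3']
    exact mul_le_mul_of_nonneg_right (hρ1.le.trans (min_le_right _ _)) (by positivity)
  have hmB : NB ≤ m + 1 := by omega
  have hmC : NC ≤ m + 1 := by omega
  obtain ⟨Λ, δC, hδC, hCw⟩ := hCall m hmC (sideLength ρ (m + 1)) hLpos hdensC hE0
  obtain ⟨δB, hδB, hBw⟩ := hBall m hmB (sideLength ρ (m + 1)) hLpos hdensB hE0 1 Λ one_pos
  clear hBall hCall
  refine ⟨min δB δC, lt_min hδB hδC, ?_⟩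
  intro Ψ hΨ p hp hwin
  have hΨB : periodicEnergy v Ψ ≤ periodicGroundStateEnergy v (m + 1) (sideLength ρ (m + 1)) + δB :=
    hΨ.trans (add_le_add (le_refl _) (min_le_left _ _))
  have hΨC : periodicEnergy v Ψ ≤ periodicGroundStateEnergy v (m + 1) (sideLength ρ (m + 1)) + δC :=
    hΨ.trans (add_le_add (le_refl _) (min_le_right _ _))
  have hwin' : 2 * Real.pi * ‖(fun j => (p j : ℝ))‖ / sideLength ρ (m + 1) ≤
      M * Real.sqrt (((m + 1 : ℕ) : ℝ) / sideLength ρ (m + 1) ^ 3) := by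
    rw [hL3]; exact hwin
  -- the witness of (C) and the one-sided KLS inequality of (B), both on `ζ = zetaOp m L p Ψ`
  obtain ⟨η, hη1, hη2, hη3, hη4, hη5, hη6, hdist, hener⟩ :=
    hCw Ψ hΨC p hp hwin' (POp m (sideLength ρ (m + 1))) rfl (QOp m (sideLength ρ (m + 1))) rfl
      (zetaOp m (sideLength ρ (m + 1)) p Ψ) rfl
  have hkls := hBw Ψ hΨB p hp hwin' (POp m (sideLength ρ (m + 1))) rfl (QOp m (sideLength ρ (m + 1))) rfl
    (zetaOp m (sideLength ρ (m + 1)) p Ψ) rfl η hη1 hη2 hη3 hη4 hη5 hη6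
  have hZocc := hD m (sideLength ρ (m + 1)) hLpos Ψ p (POp m (sideLength ρ (m + 1))) rfl
    (QOp m (sideLength ρ (m + 1))) rfl (zetaOp m (sideLength ρ (m + 1)) p Ψ) rfl
  clear hCw hBw
  have hfin : cellOccupation (m + 1) (sideLength ρ (m + 1)) (planeWaveMode (sideLength ρ (m + 1)) p) Ψ.ψ ≠ ⊤ :=
    ne_top_of_le_ne_top (ENNReal.natCast_ne_top (m + 1)) (Ψ.cellOccupation_planeWaveMode_le hLpos p)
  have hnp : 0 < ‖(fun j => (p j : ℝ))‖ := norm_intCast_pos hp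
  have hΓ : 0 ≤ C * sideLength ρ (m + 1) ^ 2 / ‖(fun j => (p j : ℝ))‖ ^ 2 := by positivity
  have hκ : 0 ≤ c₁ * (2 * Real.pi * ‖(fun j => (p j : ℝ))‖ / sideLength ρ (m + 1)) ^ 2 +
      c₂ * (((m + 1 : ℕ) : ℝ) / sideLength ρ (m + 1) ^ 3) := by positivity
  -- the real algebra, by first-order matching of the three inequalities
  have key := kls_real_algebra ENNReal.toReal_nonneg hΓ hκ hθ hkls hdist hener
  rw [hL3] at key
  have e : 8 * (C * sideLength ρ (m + 1) ^ 2 / ‖(fun j => (p j : ℝ))‖ ^ 2 *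
      (c₁ * (2 * Real.pi * ‖(fun j => (p j : ℝ))‖ / sideLength ρ (m + 1)) ^ 2 + c₂ * ρ)) + 3 =
      32 * Real.pi ^ 2 * C * c₁ + 3 +
        8 * C * c₂ * ρ * sideLength ρ (m + 1) ^ 2 / ‖(fun j => (p j : ℝ))‖ ^ 2 := by
    field_simp
    ring
  -- back to `ℝ≥0∞` and to `cellOccupation`
  have hb : 0 ≤ 32 * Real.pi ^ 2 * C * c₁ + 3 +
      8 * C * c₂ * ρ * sideLength ρ (m + 1) ^ 2 / ‖(fun j => (p j : ℝ))‖ ^ 2 := by positivity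
  rw [ENNReal.le_ofReal_iff_toReal_le hfin hb, ← hZocc]
  linarith only [key, e]

/-- **Composition, body form**: the four stub statements give `GDCan → ∀ v, PeriodicBEC(v)`. -/
theorem gdTransfer_of_parts (hA : ModeCountingStmt) (hD : ExcitationNormStmt) (hB : DualNormKLSStmt)
    (hC : HealedWitnessStmt)
    (hG : Summit.AtomisticToContinuum.BoseEinsteinCondensation.Theses.BECThomsonPrinciple.GaussianDominationCan)
    (v : ℝ → ℝ≥0∞) (hv : IsRepulsiveFiniteRange v) : PeriodicBECAt v :=
  hA v hv (perModeIR_of_parts hD hB hC hG v hv)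

/-- **The skeleton theorem**: the registered stubs close the crux `GDTransfer` BY NAME
(sorries only inside `stub_modeCounting`, `stub_excitationNorm`, `stub_dualNormKLS`, `stub_healedWitness`). -/
theorem GDTransfer_of :
    Summit.AtomisticToContinuum.BoseEinsteinCondensation.Theses.BECThomsonPrinciple.GDTransfer :=
  fun hG v hv =>
    gdTransfer_of_parts stub_modeCounting stub_excitationNorm stub_dualNormKLS stub_healedWitness hG v hv

end Summit.AtomisticToContinuum.BoseEinsteinCondensation.Cruxes.GDTransfer.DualNormHealedWitness

end
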